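import Mathlib
import Literature.Probability.Moments.AzumaHoeffdingMartingalePart
import Literature.Analysis.FluidPDE.HardSphereCollisionRecord
import Literature.MathematicalPhysics.KineticTheory.HardSphereEuler

/-!
# Crux-ideate sketch — EquilibriumClampedCollisionalWindowLD (stmt-AtomisticToContinuum-13733), ideator 1

First lemmas of the two crux idea cards (they only need to ELABORATE; nothing here is proved):

* `FreedmanMartingalePart` — card `stopped-clamp-enskog-compensator`: Freedman/Bernstein exponential
  supermartingale bound for Doob's martingale part with a PREDICTABLE (random) conditional-variance
  budget — the "Not here: predictable (random) bounds" item of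
  `Literature/Probability/Moments/AzumaHoeffdingMartingalePart.lean`, which the clamp of the crux
  supplies pathwise.
* `EquilibriumActivityOverflowLD` — card `stopped-clamp-enskog-compensator`, stub A1's price: at
  global equilibrium the COUNT of over-budget particles has vanishing window pressure.
* `StationaryCollisionBalance` — card `stationary-contact-chaos-duality`: the finite-`N` seed of the
  stationarity moment constraints on incoming contact statistics (invariance of the homogeneous
  Gibbs law + the pathwise velocity-observable balance).
-/

namespace Summit.AtomisticToContinuum.HydrodynamicLimit.Cruxes.EquilibriumClampedCollisionalWindowLD.IdeatorOne

open MeasureTheory ProbabilityTheory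

/-- Card A, first lemma (Freedman 1975, Thm 1.6; Bercu–Touati 2008): for a real process `f` strongly
adapted to `ℱ`, started at `0`, with increments a.e. bounded by `R > 0`, and whose summed CONDITIONAL
second moments of increments are a.e. bounded by `K`, the martingale part satisfies
`∫⁻ exp (t · M_n) ≤ exp (ψ(t, 2R) · K)`, `ψ(t, b) = (e^{tb} - 1 - tb)/b²`, for `t ≥ 0`. -/
def FreedmanMartingalePart : Prop :=
  ∀ (Ω : Type) (m0 : MeasurableSpace Ω) (μ : Measure Ω) [IsProbabilityMeasure μ]
    (ℱ : Filtration ℕ m0) (f : ℕ → Ω → ℝ) (R : ℝ), 0 < R → StronglyAdapted ℱ f →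
    (∀ ω, f 0 ω = 0) → (∀ᵐ ω ∂μ, ∀ i, |f (i + 1) ω - f i ω| ≤ R) →
    ∀ (n : ℕ) (t K : ℝ), 0 ≤ t → 0 ≤ K →
      (∀ᵐ ω ∂μ, (∑ i ∈ Finset.range n,
          (μ[(fun ω' => (f (i + 1) ω' - f i ω') ^ 2) | ℱ i]) ω) ≤ K) →
      ∫⁻ ω, ENNReal.ofReal (Real.exp (t * martingalePart f ℱ μ n ω)) ∂μ ≤
        ENNReal.ofReal (Real.exp ((Real.exp (2 * t * R) - 1 - 2 * t * R) / (4 * R ^ 2) * K))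

/-- Card A, stub A1's price (equilibrium twin of `CollisionActivityTails`, in COUNT / exponential
currency): under the homogeneous Gibbs law, the number of particles whose window activity exceeds the
budget `V` has vanishing window pressure BELOW AN ABSOLUTE AMPLITUDE `s₀` (≈ `3 log (1/σ)`, the free-volume
cost of a caged particle; for `λ` above it the dense blob of stmt-14441 keeps the pressure positive at every
τ): `∃σ₀ ∀… ∃s₀ ∃V₀ ∀V≥V₀ ∀ 0≤λ≤s₀ ∀ε ∃τ₀ ∀τ≥τ₀ ∃N₀ ∀N≥N₀: ∫⁻ exp (λ · #{i : a_i > V}) dG_N ≤ exp (ε (N+1))`. -/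
def EquilibriumActivityOverflowLD : Prop :=
  ∃ σ₀ : ℝ, 0 < σ₀ ∧ ∀ (a₀ θ₀ : ℝ) (u₀ : Literature.MathematicalPhysics.KineticTheory.V3), 0 < a₀ → 0 < θ₀ →
    ∀ σ : ℝ, 0 < σ → σ < σ₀ →
    ∀ Φ : (N : ℕ) → Literature.Analysis.FluidPDE.HardSphereFlow
        (Literature.Analysis.FluidPDE.Torus.geometry (Fin 3))
        (Literature.MathematicalPhysics.KineticTheory.hsDiameter σ N) (N + 1),
    ∃ s₀ : ℝ, 0 < s₀ ∧ ∃ V₀ : ℝ, 0 < V₀ ∧ ∀ V : ℝ, V₀ ≤ V → ∀ lam : ℝ, 0 ≤ lam → lam ≤ s₀ → ∀ ε : ℝ, 0 < ε →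
    ∃ τ₀ : ℝ, 0 < τ₀ ∧ ∀ τ : ℝ, τ₀ ≤ τ → ∃ N₀ : ℕ, ∀ N : ℕ, N₀ ≤ N →
      (let w : ℝ := τ * ((N : ℝ) + 1) ^ (-(1 / 3 : ℝ))
       let P := Literature.MathematicalPhysics.KineticTheory.localGibbsLaw σ (fun _ => a₀) (fun _ => u₀)
         (fun _ => θ₀) N (Φ N)
       let act := fun (i : Fin (N + 1))
         (z : Literature.Analysis.FluidPDE.Config (N + 1) (Fin 3) Literature.MathematicalPhysics.KineticTheory.T3) =>
         σ / τ * (Φ N).collisionSum (Set.Ioc 0 w)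
           (fun c => if c.fst = i then ‖c.postVel.1 - c.preVel.1‖ else 0) z
       ∫⁻ z, ENNReal.ofReal (Real.exp (lam *
           ((Finset.univ.filter (fun i : Fin (N + 1) => V < act i z)).card : ℝ))) ∂P ≤
         ENNReal.ofReal (Real.exp (ε * ((N : ℝ) + 1))))

/-- Card B, first lemma (finite-`N` seed of the stationarity moment constraints): under the homogeneous
Gibbs law (invariant under every hard-sphere flow), for every bounded continuous `ψ : ℝ³ → ℝ` and every
window `(0, w]`, the expected collision sum of `ψ(v_i⁺) + ψ(v_j⁺) - ψ(v_i⁻) - ψ(v_j⁻)` vanishes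
(pathwise it is twice `Σ_i ψ(v_i(w)) - Σ_i ψ(v_i(0))` on good orbits, ordered pairs counted twice). -/
def StationaryCollisionBalance : Prop :=
  ∀ (σ a₀ θ₀ : ℝ) (u₀ : Literature.MathematicalPhysics.KineticTheory.V3) (N : ℕ), 0 < σ →
    Literature.MathematicalPhysics.KineticTheory.hsDiameter σ N < 2⁻¹ →
    ∀ (Φ : Literature.Analysis.FluidPDE.HardSphereFlow
        (Literature.Analysis.FluidPDE.Torus.geometry (Fin 3))
        (Literature.MathematicalPhysics.KineticTheory.hsDiameter σ N) (N + 1))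
      (ψ : Literature.MathematicalPhysics.KineticTheory.V3 → ℝ), Continuous ψ → (∃ C : ℝ, ∀ v, |ψ v| ≤ C) →
    ∀ w : ℝ, 0 ≤ w →
      ∫ z, Φ.collisionSum (Set.Ioc 0 w)
          (fun c => ψ c.postVel.1 + ψ c.postVel.2 - ψ c.preVel.1 - ψ c.preVel.2) z
        ∂(Literature.MathematicalPhysics.KineticTheory.localGibbsLaw σ (fun _ => a₀) (fun _ => u₀)
            (fun _ => θ₀) N Φ) = 0

end Summit.AtomisticToContinuum.HydrodynamicLimit.Cruxes.EquilibriumClampedCollisionalWindowLD.IdeatorOne
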